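import Summits.QuantumFields.BalabanUV.Beta.GAN24.DerivativeRateTransferJensenMassFreeKarcherLocal
import Summits.QuantumFields.BalabanUV.Beta.GAN24.DerivativeRateTransferJensenMassFreeExpMeanEnd

/-!
# `BalabanUV.Beta.GAN24.DerivativeRateTransferJensenMassFreeKarcherEnd` — binder row G-an2-4 ∕ (CONV-C), route R6 «VALUES, NOT DERIVATIVES», PART 83:
# THE (1.27) PAIR's (STAB-ε,δ) FROM THE FINE FIELD AND THE LOCAL LOOP LETTER — PART 72's capstone for the THIRD printed convention: from PART 62's fine-field
# hypotheses, the support-local loop letter with `0 ≤ D < 1` and `√(dim o)·D ≤ 1∕200`, and in-degree `d′`, for ANY prescribed roots of nonzero weight there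
# are polar links `R′` AND Karcher bases `V(e′)` (orthogonal; skew logarithms on the supports with `Σ_{q≠0} q•C(e′,·) = 0` — Bałaban–Jaffe's (1.29) at every
# coarse bond) such that (i) PART 62's `δ = 0` END holds for the polar pair and (ii) for every coarse form dominated by the KARCHER links' energy
#   `⟨Qu, H‴_cQu⟩ ≤ (1+s)(1 + ε(2D,ϖ,ϖ′;t,r))·⟨u, H_fu⟩ + (1+s⁻¹)·(1280D_F³ + 200704D_F⁴)²·w_c·d′·⟨Qu, Qu⟩`,  `D_F = √(dim o)·D`
# — MASSIVE-SMALL by transfer, `δ` SIXTH ORDER in the loop letter, exactly as PART 72 for (1.28) (unit b2b-balaban-gan24-p3, gen 46; v1)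

NOT IN PRINT; OUR PROOF (for the ROUTE; PART 72 `covJensen_transfer_of_polar_local` + PART 62 `covJensen_polar_massFree_of_loops_local` + PART 58 `exists_polarLink`
+ PART 82 `transferLetter_karcher_local` BY NAME — PART 72's proof with the (1.28) links replaced by the Karcher bases).  HONEST FRAMING (cell contract, verbatim):
«discharging `BetaPertH` makes Bałaban's UV stability UNCONDITIONAL — a real constructive-QFT result; it is NOT the continuum limit and NOT the Clay problem.»
HONEST DEPENDENCY (verbatim): «continuum YM on T⁴ ⇐ BetaPertH ∧ nine spine estimates (0/9 proved); BetaPertH ⇐ (D1) ∧ (D4) ∧ CAP+tail; G-an2-4 gates asym,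
D1 and NE2/3/4.»

WHAT THIS FILE PROVES (0 sorry, 0 `def`, nothing cited): **`exists_polar_karcher_covJensen_local`**.  HONEST SCOPE: PART 62's abstraction level (the block lattice
of PARTs 63 ∕ 64 ∕ 74 ∕ 75 is one `refine` away — ON REQUEST); the roots are prescribed (any site of nonzero weight; print: the central contour `U(yy′)`);
window `√(dim o)·D ≤ 1∕200` (PART 77), crude constants; ONE scale; NOT the tower, NOT (CONS), NOT (CONV-C).  SUPPLIER work on route R6 (rank 2, REDUCTION, no
seat); no consumer of record; NEVER «G-an2-4 closed»; NOT (CONV-C), NOT D1, NOT `BetaPertH`, NOT continuum, NOT Clay.  Records: `HOME/b2b-balaban-gan24-p3/WOODBURY-FIBRE.md` v14.6. -/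

noncomputable section

open scoped Matrix Matrix.Norms.Frobenius
open NormedSpace Matrix Finset

namespace Summit.QuantumFields.BalabanUV.Beta.GAN24.DerivativeRateTransferJensenMassFreeKarcherEnd

open Summit.QuantumFields.BalabanUV.Beta.GAN24.DerivativeRateTransferJensenChain
open Summit.QuantumFields.BalabanUV.Beta.GAN24.DerivativeRateTransferJensenMassFreeTransfer
open Summit.QuantumFields.BalabanUV.Beta.GAN24.DerivativeRateTransferJensenMassFreePolarFactor
open Summit.QuantumFields.BalabanUV.Beta.GAN24.DerivativeRateTransferJensenMassFreeLocalEnd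
open Summit.QuantumFields.BalabanUV.Beta.GAN24.DerivativeRateTransferJensenMassFreeConventionLocal
open Summit.QuantumFields.BalabanUV.Beta.GAN24.DerivativeRateTransferJensenMassFreeExpMeanEnd
open Summit.QuantumFields.BalabanUV.Beta.GAN24.DerivativeRateTransferJensenMassFreeKarcherLocal

section End

variable {o μ ν β β' : Type*} [Fintype o] [DecidableEq o] [Fintype μ] [DecidableEq μ] [Fintype ν] [Fintype β] [DecidableEq β] [Fintype β']
variable {q : μ → ν → ℝ} {W : μ → ν → Matrix o o ℝ} {Q : Matrix (μ × o) (ν × o) ℝ}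
variable {src tgt : β → ν} {R : β → Matrix o o ℝ} {src' tgt' : β' → μ}
variable {Hf : Matrix (ν × o) (ν × o) ℝ} {wf : ℝ}
variable {σ : β' → ν ≃ ν} {ℓ : ℕ} {xs : β' → ν → ℕ → ν} {γ : β' → ν → ℕ → β} {T : β' → ν → ℕ → Matrix o o ℝ} {m : ℝ}
variable {D d' : ℝ}

/-- **`exists_polar_karcher_covJensen_local` — THE POLAR PAIR's AND THE KARCHER PAIR's ENDs FROM THE FINE FIELD AND THE LOCAL LOOP LETTER** [our proof; PART 72's
capstone for Bałaban–Jaffe's (1.27) ∕ (1.29)].  Data about the FINE field only (PART 62's letters): block weights, orthogonal `W` and `R`, the averaging identity,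
`H_f ≥ w_fΣ_e|D_eu|²`, pairings, straight chains with multiplicity `≤ m`, the support-local loop letter with `0 ≤ D < 1` and `√(dim o)·D ≤ 1∕200`, in-degree
`≤ d′`.  For ANY prescribed roots `x₀(e′)` of nonzero weight THEN there are (a) polar links `R′` (orthogonal), (b) orthogonal KARCHER BASES `V(e′)` with skew
logarithms `C(e′,x)` on the supports (`exp(C(e′,x))·V(e′) = τ(e′,x)`, `‖C(e′,x)‖ ≤ 8√(dim o)D`, `Σ_{q≠0} q(src′e′,x)•C(e′,x) = 0`, `τ = W T W′ᵀ`), such that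
for every `w_c ≥ 0` with `w_c·ℓ·m ≤ w_f`, every `u` with Poincaré data and all `s, t, r > 0`: (i) for every `H_c ≤ w_cΣ|R′v − v|²`, PART 62's `δ = 0` END;
(ii) for every `H‴_c ≤ w_cΣ|V v − v|²` (the (1.27) ∕ (1.29) convention):
`⟨Qu, H‴_cQu⟩ ≤ (1+s)(1 + ε)·⟨u, H_fu⟩ + (1+s⁻¹)·(1280D_F³ + 200704D_F⁴)²·w_c·d′·⟨Qu, Qu⟩`, `D_F = √(dim o)·D`. -/
theorem exists_polar_karcher_covJensen_local
    (hq : ∀ y x, 0 ≤ q y x) (hq1 : ∀ y, ∑ x, q y x = 1) (hW : ∀ y x, (W y x)ᵀ * W y x = 1) (hR : ∀ e, (R e)ᵀ * R e = 1)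
    (hQ : ∀ (u : ν × o → ℝ) (y : μ), (fun a => (Q *ᵥ u) (y, a)) = ∑ x, q y x • (W y x *ᵥ fun b => u (x, b)))
    (hHf : ∀ u : ν × o → ℝ, wf * ∑ e, ((R e *ᵥ fun b => u (tgt e, b)) - fun b => u (src e, b)) ⬝ᵥ
        ((R e *ᵥ fun b => u (tgt e, b)) - fun b => u (src e, b)) ≤ u ⬝ᵥ (Hf *ᵥ u))
    (hσq : ∀ e' x, q (tgt' e') (σ e' x) = q (src' e') x)
    (hx0 : ∀ e' x, xs e' x 0 = x) (hxℓ : ∀ e' x, xs e' x ℓ = σ e' x)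
    (hsrc : ∀ e' x i, i < ℓ → src (γ e' x i) = xs e' x i) (htgt : ∀ e' x i, i < ℓ → tgt (γ e' x i) = xs e' x (i + 1))
    (hT0 : ∀ e' x, T e' x 0 = 1) (hT : ∀ e' x i, i < ℓ → T e' x (i + 1) = T e' x i * R (γ e' x i))
    (hmult : ∀ e, ∑ e', ∑ x, ∑ i ∈ range ℓ, (if γ e' x i = e then q (src' e') x else 0) ≤ m)
    (hloop : ∀ e' x x', q (src' e') x ≠ 0 → q (src' e') x' ≠ 0 → ∀ w : o → ℝ,
      (((W (src' e') x * T e' x ℓ * (W (tgt' e') (σ e' x))ᵀ)ᵀ * (W (src' e') x' * T e' x' ℓ * (W (tgt' e') (σ e' x'))ᵀ) - 1) *ᵥ w) ⬝ᵥ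
          (((W (src' e') x * T e' x ℓ * (W (tgt' e') (σ e' x))ᵀ)ᵀ * (W (src' e') x' * T e' x' ℓ * (W (tgt' e') (σ e' x'))ᵀ) - 1) *ᵥ w) ≤
        D ^ 2 * (w ⬝ᵥ w))
    (hD0 : 0 ≤ D) (hD1 : D < 1) (hD200 : Real.sqrt (Fintype.card o) * D ≤ 1 / 200)
    (hdeg : ∀ y, ((Finset.univ.filter fun e' => tgt' e' = y).card : ℝ) ≤ d') {x₀ : β' → ν} (hx₀ : ∀ e', q (src' e') (x₀ e') ≠ 0) :
    ∃ (R' V : β' → Matrix o o ℝ) (C : ∀ e' : β', {x : ν // q (src' e') x ≠ 0} → Matrix o o ℝ),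
      (∀ e', (R' e')ᵀ * R' e' = 1) ∧ (∀ e', (V e')ᵀ * V e' = 1) ∧
      (∀ e', ‖V e' * (W (src' e') (x₀ e') * T e' (x₀ e') ℓ * (W (tgt' e') (σ e' (x₀ e')))ᵀ)ᵀ - 1‖ ≤ 8 * (Real.sqrt (Fintype.card o) * D)) ∧
      (∀ e' x, (C e' x)ᵀ = -C e' x) ∧
      (∀ e' x, exp (C e' x) * V e' = W (src' e') x * T e' x ℓ * (W (tgt' e') (σ e' x))ᵀ) ∧
      (∀ e' x, ‖C e' x‖ ≤ 8 * (Real.sqrt (Fintype.card o) * D)) ∧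
      (∀ e', ∑ x : {x : ν // q (src' e') x ≠ 0}, q (src' e') x • C e' x = 0) ∧
      ∀ (wc : ℝ) (_hwc : 0 ≤ wc) (_hw : wc * ℓ * m ≤ wf) (u : ν × o → ℝ) (Φ : (ν × o → ℝ) → μ → ℝ) (ϖ ϖ' : ℝ)
        (_hP : ∀ y, ∑ x, q y x * (((W y x *ᵥ fun b => u (x, b)) - fun a => (Q *ᵥ u) (y, a)) ⬝ᵥ
          ((W y x *ᵥ fun b => u (x, b)) - fun a => (Q *ᵥ u) (y, a))) ≤ Φ u y)
        (_hΦ : wc * ∑ e', Φ u (tgt' e') ≤ ϖ * (u ⬝ᵥ (Hf *ᵥ u))) (_hΦ' : wc * ∑ e', Φ u (src' e') ≤ ϖ' * (u ⬝ᵥ (Hf *ᵥ u)))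
        (s t r : ℝ) (_hs : 0 < s) (_ht : 0 < t) (_hr : 0 < r),
        (∀ Hc : Matrix (μ × o) (μ × o) ℝ,
          (∀ v : μ × o → ℝ, v ⬝ᵥ (Hc *ᵥ v) ≤
            wc * ∑ e', ((R' e' *ᵥ fun a => v (tgt' e', a)) - fun a => v (src' e', a)) ⬝ᵥ
              ((R' e' *ᵥ fun a => v (tgt' e', a)) - fun a => v (src' e', a))) →
          (Q *ᵥ u) ⬝ᵥ (Hc *ᵥ (Q *ᵥ u)) ≤
            (1 + t + (1 + t⁻¹) * (1 + r) * ϖ * (2 * D) ^ 2 +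
                (1 + t⁻¹) * (1 + r⁻¹) * (3 * (2 * D) ^ 2 / (4 - (2 * D) ^ 2)) * (1 + ϖ + ϖ')) * (u ⬝ᵥ (Hf *ᵥ u))) ∧
        (∀ Hc''' : Matrix (μ × o) (μ × o) ℝ,
          (∀ v : μ × o → ℝ, v ⬝ᵥ (Hc''' *ᵥ v) ≤
            wc * ∑ e', ((V e' *ᵥ fun a => v (tgt' e', a)) - fun a => v (src' e', a)) ⬝ᵥ
              ((V e' *ᵥ fun a => v (tgt' e', a)) - fun a => v (src' e', a))) →
          (Q *ᵥ u) ⬝ᵥ (Hc''' *ᵥ (Q *ᵥ u)) ≤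
            (1 + s) * ((1 + t + (1 + t⁻¹) * (1 + r) * ϖ * (2 * D) ^ 2 +
                (1 + t⁻¹) * (1 + r⁻¹) * (3 * (2 * D) ^ 2 / (4 - (2 * D) ^ 2)) * (1 + ϖ + ϖ')) * (u ⬝ᵥ (Hf *ᵥ u))) +
              (1 + s⁻¹) * (1280 * (Real.sqrt (Fintype.card o) * D) ^ 3 + 200704 * (Real.sqrt (Fintype.card o) * D) ^ 4) ^ 2 * wc * d' *
                ((Q *ᵥ u) ⬝ᵥ (Q *ᵥ u))) := by
  -- (a) the polar links
  obtain ⟨R', hR'o, hsym, hPpsd⟩ := exists_polarLink (W := W) (T := T) (σ := σ) (src' := src') (tgt' := tgt') (ℓ := ℓ) hq hq1 hloop hD0 hD1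
  -- the open transports are orthogonal
  have hτo : ∀ e' x, (W (src' e') x * T e' x ℓ * (W (tgt' e') (σ e' x))ᵀ)ᵀ * (W (src' e') x * T e' x ℓ * (W (tgt' e') (σ e' x))ᵀ) = 1 :=
    fun e' x => orthogonal_mul (orthogonal_mul (hW _ _)
      (orthogonal_partialTransport (R := fun i => R (γ e' x i)) (fun i _ => hR _) (hT0 e' x) (fun i hi => hT e' x i hi) ℓ le_rfl))
      (transpose_orthogonal (hW _ _))
  -- (b) the Karcher bases and the transfer letter
  obtain ⟨V, C, hV, hV1, hCt, hCe, hC8, h0, hletter⟩ := transferLetter_karcher_local (o := o)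
    (τ := fun e' x => W (src' e') x * T e' x ℓ * (W (tgt' e') (σ e' x))ᵀ) hq hq1 hτo hD0 hloop hD200 hx₀
  have hτ' := hletter R' hR'o hsym hPpsd
  refine ⟨R', V, C, hR'o, hV, hV1, hCt, hCe, hC8, h0, ?_⟩
  intro wc hwc hw u Φ ϖ ϖ' hP hΦ hΦ' s t r hs ht hr
  refine ⟨fun Hc hHc => ?_, fun Hc''' hHc''' => ?_⟩
  · exact covJensen_polar_massFree_of_loops_local (N := fun e' x => 1 - W (src' e') x * T e' x ℓ * (W (tgt' e') (σ e' x))ᵀ * (R' e')ᵀ)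
      hq hq1 hW hR hR'o hQ hwc hHc hHf hσq hx0 hxℓ hsrc htgt hT0 hT hmult hw (fun _ _ => rfl) hsym hPpsd hloop hD1 hD0 u hP hΦ hΦ' ht hr
  · exact covJensen_transfer_of_polar_local (R'' := V)
      hq hq1 hW hR hR'o hQ hwc hHc''' hτ' hHf hσq hx0 hxℓ hsrc htgt hT0 hT hmult hw hsym hPpsd hloop hD0 hD1 hdeg u hP hΦ hΦ' hs ht hr

end End

end Summit.QuantumFields.BalabanUV.Beta.GAN24.DerivativeRateTransferJensenMassFreeKarcherEnd

end
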